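import Summits.ValiantsHypothesis.ValiantsHypothesis.Theorems.DefinabilityGapAffineRung
import Literature.Barriers.ValiantsHypothesis.CT23AnnihilatorPrefixColumns
import HarnessLib

/-!
# DefinabilityGap — the CEILING of the degree road: annihilators of degree `≤ q(m)²` exist for EVERY `m`

Route `route-ValiantsHypothesis-DefinabilityGap` (decomp-valiant lens 5, gen 16), items `KIPlantedHitting`
(stmt-ValiantsHypothesis-23547, clause ladder `b ↦ "every nonzero D of size ≤ q^b AND degree ≤ q^b is hit by G_m
for infinitely many m"`) and `KIAnnihilatorCHDefinable` (stmt-ValiantsHypothesis-23444, the degree profile of the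
annihilator ideal of the planted Kabanets–Impagliazzo permanent generator `G_m = kiPer m : ℂ^{q²} → ℂ^{q³}`).

The **degree road** is the sequence of kernel rungs "no nonzero annihilator of `G_m` of total degree `≤ t`"
(`kiPer_hits_affine`: `t = 1`; `kiPer_hits_quadratic`: `t = 2`, `m ≥ 3`; `kiPer_hits_lowDegree`: `2t < m`). This file
proves its CEILING as a theorem (BC9 doctrine "every rung a theorem and the ceiling a theorem"):

* `exists_annihilator_of_choose_lt` — the dimension count, for ANY tuple of bounded-degree polynomials over a field:
  if `binom(n + d·T, d·T) < binom(N + T, T)` then `N` polynomials in `n` variables of degree `≤ d` have a nonzero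
  annihilator of total degree `≤ T` [folklore; the linear algebra of `Literature/…/CT23AnnihilatorPrefixColumns`];
* `exists_annihilator_totalDegree_le_of_choose_lt` — the same for `G_m` (`N = q³`, `n = q²`, `d = m`);
* `exists_annihilator_totalDegree_le_sq` — **for every `m` there is a nonzero `D` with `D ∘ G_m = 0` and
  `deg D ≤ q(m)²`** (the count holds at `T = q²` because `m < q`); this sharpens the tree's
  `exists_lowDegree_annihilator` (`deg ≤ q³`, for all large `m`, via the `VPSPACE⁰` rung) to `q²` and to ALL `m`,
  by elementary means;
* `not_degreeOnlyHitting_two` / `not_degreeOnlyHitting_of_two_le` — consequently the DEGREE-ONLY form of clause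
  `b = 2` of `KIPlantedHitting` ("for infinitely many `m`, every nonzero `D` of degree `≤ q^b` is hit", with NO size
  bound) is FALSE for every `b ≥ 2`: any proof of clause `b ≥ 2` must use the circuit-size hypothesis, and the degree
  road on its own is confined to `b ≤ 1` (its live target, `t₀(m) > q(m)` infinitely often, is open; `b = 0` is the
  affine rung, `degreeOnlyHitting_zero`).

Honest placement: rung 0 of the Valiant ladder; negative knowledge about ONE certificate METHOD for item 23547 and an
upper bound `t₀(m) ≤ q(m)²` on the initial degree of the annihilator ideal (item 23444's degree profile). `VP ≠ VNP` is
not proved and nothing here bears on it directly. 0 sorry.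
-/

noncomputable section

set_option linter.dupNamespace false

open MvPolynomial
open Literature.Computability.AlgebraicComplexity Literature.Computability.MetaComplexity
open Literature.Barriers.ValiantsHypothesis

namespace Summit.ValiantsHypothesis.ValiantsHypothesis.Theorems.DefinabilityGapDegreeRoadCeiling

open Summit.ValiantsHypothesis.ValiantsHypothesis.Theorems.DefinabilityGapAffineRung

/-! ## 1. The dimension count (any field, any bounded-degree tuple) -/

section Count

variable {F : Type*} [Field F]

/-- A monomial substitution `x^e ↦ ∏ G_i^{e_i}` of a tuple of degree `≤ d` polynomials has degree `≤ d · |e|`.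
[folklore] -/
theorem totalDegree_aeval_monomial_le {N n d : ℕ} (G : Fin N → MvPolynomial (Fin n) F)
    (hG : ∀ i, (G i).totalDegree ≤ d) (e : Fin N →₀ ℕ) :
    (aeval G (monomial e (1 : F))).totalDegree ≤ d * e.degree := by
  classical
  rw [aeval_monomial, map_one, one_mul, Finsupp.prod, Finsupp.degree_apply, Finset.mul_sum]
  refine (totalDegree_finsetProd _ _).trans (Finset.sum_le_sum fun i _ => ?_)
  calc (G i ^ e i).totalDegree ≤ e i * (G i).totalDegree := totalDegree_pow _ _
    _ ≤ e i * d := Nat.mul_le_mul_left _ (hG i)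
    _ = d * e i := Nat.mul_comm _ _

/-- **Annihilators by counting dimensions.** If there are more monomials of degree `≤ T` in `N` variables than the
dimension `binom(n + dT, dT)` of the polynomials of degree `≤ dT` in `n` variables, then every `N`-tuple `G` of
`n`-variate polynomials of degree `≤ d` has a NONZERO annihilator of total degree `≤ T`. [folklore] -/
theorem exists_annihilator_of_choose_lt {N n d T : ℕ} (G : Fin N → MvPolynomial (Fin n) F)
    (hG : ∀ i, (G i).totalDegree ≤ d) (hcount : (n + d * T).choose (d * T) < (N + T).choose T) :
    ∃ D : MvPolynomial (Fin N) F, D ≠ 0 ∧ aeval G D = 0 ∧ D.totalDegree ≤ T := by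
  classical
  -- the exponents of degree `≤ T`
  haveI hfinι : Finite {e : Fin N →₀ ℕ // e.degree ≤ T} :=
    (Finsupp.finite_of_degree_le (σ := Fin N) T).to_subtype
  letI : Fintype {e : Fin N →₀ ℕ // e.degree ≤ T} := Fintype.ofFinite _
  have hcard : Fintype.card {e : Fin N →₀ ℕ // e.degree ≤ T} = (N + T).choose T := by
    rw [Fintype.card_eq_nat_card]
    exact GKSS2017.ncard_degLE N T
  -- the target space: the polynomials of degree `≤ dT` in `n` variables, dimension `binom(n + dT, dT)`
  haveI : Module.Finite F (restrictTotalDegree (Fin n) F (d * T)) := by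
    have hfin : {e : Fin n →₀ ℕ | (e.sum fun _ k => k) ≤ d * T}.Finite := by
      have h : {e : Fin n →₀ ℕ | (e.sum fun _ k => k) ≤ d * T} = {e : Fin n →₀ ℕ | e.degree ≤ d * T} := by
        ext e; simp [Finsupp.degree_apply, Finsupp.sum]
      rw [h]
      exact Finsupp.finite_of_degree_le (d * T)
    haveI := hfin.to_subtype
    exact Module.Finite.of_basis (basisRestrictSupport F _)
  have hW : Module.finrank F (restrictTotalDegree (Fin n) F (d * T)) = (n + d * T).choose (d * T) :=
    finrank_restrictTotalDegree n (d * T)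
  -- the substituted monomials land in the target space
  let w : {e : Fin N →₀ ℕ // e.degree ≤ T} → MvPolynomial (Fin n) F :=
    fun e => aeval G (monomial e.1 (1 : F))
  have hw : ∀ e, w e ∈ restrictTotalDegree (Fin n) F (d * T) := by
    intro e
    rw [mem_restrictTotalDegree]
    exact (totalDegree_aeval_monomial_le G hG e.1).trans (Nat.mul_le_mul_left _ e.2)
  -- hence they are linearly dependent
  let eqv := Fintype.equivFin {e : Fin N →₀ ℕ // e.degree ≤ T}
  have hdep : ¬ LinearIndependent F (w ∘ eqv.symm) :=
    not_linearIndependent_of_finrank_lt (restrictTotalDegree (Fin n) F (d * T)) _ (fun j => hw _)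
      (by rw [hW, hcard]; exact hcount)
  have hdep' : ¬ LinearIndependent F w := fun h => hdep (h.comp _ eqv.symm.injective)
  rw [Fintype.not_linearIndependent_iff] at hdep'
  obtain ⟨g, hg0, i₀, hi₀⟩ := hdep'
  -- the corresponding combination of monomials is the annihilator
  refine ⟨∑ e, g e • monomial e.1 (1 : F), ?_, ?_, ?_⟩
  · intro h0
    have hli : LinearIndependent F (fun e : {e : Fin N →₀ ℕ // e.degree ≤ T} => monomial e.1 (1 : F)) := by
      have hb := (basisMonomials (Fin N) F).linearIndependent
      rw [coe_basisMonomials] at hb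
      exact hb.comp _ Subtype.val_injective
    exact hi₀ (Fintype.linearIndependent_iff.1 hli g h0 i₀)
  · rw [map_sum]
    simp_rw [map_smul]
    exact hg0
  · refine totalDegree_finsetSum_le fun e _ => (totalDegree_smul_le _ _).trans ?_
    refine (totalDegree_monomial_le _ _).trans ?_
    have : (e.1.sum fun _ ↦ id) = e.1.degree := by
      simp [Finsupp.degree_apply, Finsupp.sum]
    rw [this]
    exact e.2

end Count

/-! ## 2. The count for the planted generator `G_m` -/

/-- `m < q(m)`. [folklore] -/
theorem lt_qOf (m : ℕ) : m < qOf m := by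
  have h := (qOf_spec m).1
  have : m ≤ m * m := by
    rcases Nat.eq_zero_or_pos m with h0 | h0
    · simp [h0]
    · exact Nat.le_mul_of_pos_left m h0
  omega

/-- Every coordinate `per_m(y|S_c)` of `G_m` has total degree `≤ m`. [folklore] -/
theorem totalDegree_kiPer_le (m : ℕ) (c : Fin 3 → Fin (qOf m)) : (kiPer m c).totalDegree ≤ m := by
  unfold kiPer
  rw [kiGenerator_apply]
  exact (totalDegree_rename_le _ _).trans (totalDegree_perPad_le _)

/-- **Degree-`T` annihilators of `G_m` by counting**: if `binom(q² + mT, mT) < binom(q³ + T, T)` then `G_m` has a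
nonzero annihilator of total degree `≤ T` (transport of `exists_annihilator_of_choose_lt` along enumerations of the
`q³` coordinates and the `q²` seed variables). [this file] -/
theorem exists_annihilator_totalDegree_le_of_choose_lt (m T : ℕ)
    (hcount : (qOf m * qOf m + m * T).choose (m * T) < (qOf m ^ 3 + T).choose T) :
    ∃ D : MvPolynomial (Fin 3 → Fin (qOf m)) ℂ, D ≠ 0 ∧ bind₁ (kiPer m) D = 0 ∧ D.totalDegree ≤ T := by
  classical
  -- enumerate coordinates and seed variables
  let eσ : (Fin 3 → Fin (qOf m)) ≃ Fin (qOf m ^ 3) :=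
    Fintype.equivFinOfCardEq (by simp [Fintype.card_fin])
  let eτ : (Fin (qOf m) × Fin (qOf m)) ≃ Fin (qOf m * qOf m) :=
    Fintype.equivFinOfCardEq (by simp [Fintype.card_prod, Fintype.card_fin])
  let G : Fin (qOf m ^ 3) → MvPolynomial (Fin (qOf m * qOf m)) ℂ :=
    fun i => rename eτ (kiPer m (eσ.symm i))
  have hG : ∀ i, (G i).totalDegree ≤ m := fun i =>
    (totalDegree_rename_le _ _).trans (totalDegree_kiPer_le m _)
  obtain ⟨D', hD'0, hD'ann, hD'deg⟩ := exists_annihilator_of_choose_lt G hG hcount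
  refine ⟨rename eσ.symm D', ?_, ?_, (totalDegree_rename_le _ _).trans hD'deg⟩
  · intro h
    exact hD'0 (rename_injective _ eσ.symm.injective (by rw [h, map_zero]))
  · -- `aeval G = rename eτ ∘ aeval (kiPer m ∘ eσ⁻¹)` and `rename eτ` is injective
    have hcomp : rename eτ (aeval (kiPer m ∘ eσ.symm) D') = aeval G D' := by
      rw [← AlgHom.comp_apply, comp_aeval]
      rfl
    have hzero : aeval (kiPer m ∘ eσ.symm) D' = 0 := by
      apply rename_injective _ eτ.injective
      rw [hcomp, hD'ann, map_zero]
    change aeval (kiPer m) (rename eσ.symm D') = 0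
    rw [aeval_rename]
    exact hzero

/-- The count holds at `T = q²` for EVERY `m`: `binom(q² + m q², m q²) = binom((m+1) q², q²) < binom((q+1) q², q²)`
because `m < q`. [this file] -/
theorem choose_sq_lt (m : ℕ) :
    (qOf m * qOf m + m * (qOf m * qOf m)).choose (m * (qOf m * qOf m)) <
      (qOf m ^ 3 + qOf m * qOf m).choose (qOf m * qOf m) := by
  have hq : 1 ≤ qOf m := (qOf_spec m).2.one_lt.le
  have hmq : m < qOf m := lt_qOf m
  set Q := qOf m * qOf m with hQ
  have hQpos : 0 < Q := Nat.mul_pos hq hq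
  -- symmetry of the binomial coefficient
  rw [← Nat.choose_symm_add]
  -- strict monotonicity in the top argument: one strict step, then monotone
  have hstep : (Q + m * Q).choose Q < (Q + m * Q + 1).choose Q := by
    rw [Nat.choose_succ_left _ _ hQpos]
    have : 0 < (Q + m * Q).choose (Q - 1) := Nat.choose_pos (by omega)
    omega
  refine lt_of_lt_of_le hstep (Nat.choose_le_choose Q ?_)
  have h3 : qOf m ^ 3 = qOf m * Q := by rw [hQ]; ring
  rw [h3]
  have : m * Q + 1 ≤ qOf m * Q := by
    have : (m + 1) * Q ≤ qOf m * Q := Nat.mul_le_mul_right Q hmq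
    nlinarith
  omega

/-- **For every `m`, `G_m` has a nonzero annihilator of total degree `≤ q(m)²`.** [this file] -/
theorem exists_annihilator_totalDegree_le_sq (m : ℕ) :
    ∃ D : MvPolynomial (Fin 3 → Fin (qOf m)) ℂ, D ≠ 0 ∧ bind₁ (kiPer m) D = 0 ∧
      D.totalDegree ≤ qOf m * qOf m :=
  exists_annihilator_totalDegree_le_of_choose_lt m _ (choose_sq_lt m)

/-- The same with the bound written `q(m) ^ b`, any `b ≥ 2`. [this file] -/
theorem exists_annihilator_totalDegree_le_pow (m : ℕ) {b : ℕ} (hb : 2 ≤ b) :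
    ∃ D : MvPolynomial (Fin 3 → Fin (qOf m)) ℂ, D ≠ 0 ∧ bind₁ (kiPer m) D = 0 ∧
      D.totalDegree ≤ qOf m ^ b := by
  obtain ⟨D, hD0, hann, hdeg⟩ := exists_annihilator_totalDegree_le_sq m
  refine ⟨D, hD0, hann, hdeg.trans ?_⟩
  have hq : 1 ≤ qOf m := (qOf_spec m).2.one_lt.le
  calc qOf m * qOf m = qOf m ^ 2 := by ring
    _ ≤ qOf m ^ b := Nat.pow_le_pow_right hq hb

/-! ## 3. The degree road is confined to `b ≤ 1` -/

/-- **The degree-only form of clause `b = 2` of `KIPlantedHitting` is FALSE**: it is not the case that for infinitely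
many `m` every nonzero `D` of total degree `≤ q(m)²` is hit by `G_m` — for EVERY `m` a degree-`≤ q²` annihilator exists.
Hence a proof of clause `b = 2` must use the size bound `complexity D ≤ q²`; the degree road alone cannot reach it.
[this file] -/
theorem not_degreeOnlyHitting_two :
    ¬ (∀ m₀ : ℕ, ∃ m, m₀ ≤ m ∧ ∀ D : MvPolynomial (Fin 3 → Fin (qOf m)) ℂ, D ≠ 0 →
        D.totalDegree ≤ qOf m ^ 2 → bind₁ (kiPer m) D ≠ 0) := by
  intro h
  obtain ⟨m, -, hm⟩ := h 0
  obtain ⟨D, hD0, hann, hdeg⟩ := exists_annihilator_totalDegree_le_pow m (le_refl 2)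
  exact hm D hD0 hdeg hann

/-- … and the same for every `b ≥ 2`. [this file] -/
theorem not_degreeOnlyHitting_of_two_le {b : ℕ} (hb : 2 ≤ b) :
    ¬ (∀ m₀ : ℕ, ∃ m, m₀ ≤ m ∧ ∀ D : MvPolynomial (Fin 3 → Fin (qOf m)) ℂ, D ≠ 0 →
        D.totalDegree ≤ qOf m ^ b → bind₁ (kiPer m) D ≠ 0) := by
  intro h
  obtain ⟨m, -, hm⟩ := h 0
  obtain ⟨D, hD0, hann, hdeg⟩ := exists_annihilator_totalDegree_le_pow m hb
  exact hm D hD0 hdeg hann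

/-- The bottom of the same ladder IS a theorem: the degree-only clause `b = 0` (no AFFINE annihilator, infinitely
often — in fact for every `m ≥ 3`) is the affine rung `kiPer_hits_affine`. The live degree-road target is `b = 1`
(`t₀(m) > q(m)` infinitely often), strictly between this theorem and `not_degreeOnlyHitting_two`. [this file] -/
theorem degreeOnlyHitting_zero :
    ∀ m₀ : ℕ, ∃ m, m₀ ≤ m ∧ ∀ D : MvPolynomial (Fin 3 → Fin (qOf m)) ℂ, D ≠ 0 →
        D.totalDegree ≤ qOf m ^ 0 → bind₁ (kiPer m) D ≠ 0 := by
  intro m₀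
  refine ⟨max m₀ 3, le_max_left _ _, fun D hD hdeg => ?_⟩
  exact kiPer_hits_affine (le_max_right _ _) D hD (by simpa using hdeg)

/-- **Initial-degree sandwich** (items 23547/23444, the kernel record in one statement): for every `m ≥ 3` the least
total degree of a nonzero annihilator of `G_m` exists and lies in `[2, q(m)²]` — some nonzero annihilator has degree
`≤ q²`, and every nonzero annihilator has degree `≥ 2` (`kiPer_hits_affine`; the quadratic and `2t < m` rungs of the
tree sharpen the lower end). [this file] -/
theorem annihilator_initialDegree_window {m : ℕ} (hm : 3 ≤ m) :
    (∃ D : MvPolynomial (Fin 3 → Fin (qOf m)) ℂ, D ≠ 0 ∧ bind₁ (kiPer m) D = 0 ∧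
        D.totalDegree ≤ qOf m * qOf m) ∧
      ∀ D : MvPolynomial (Fin 3 → Fin (qOf m)) ℂ, D ≠ 0 → bind₁ (kiPer m) D = 0 → 2 ≤ D.totalDegree := by
  refine ⟨exists_annihilator_totalDegree_le_sq m, fun D hD hann => ?_⟩
  by_contra hlt
  exact kiPer_hits_affine hm D hD (by omega) hann

end Summit.ValiantsHypothesis.ValiantsHypothesis.Theorems.DefinabilityGapDegreeRoadCeiling
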